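import Summits.Ventures.WeilGRH.DualTrigKernelLatticeDefs
import HarnessLib

/-!
# Format D-K v3 (multi-lattice): soundness, part A — the non-periodic list of the base terms

Cell `rh-explicit`, WEIL TRACK — GRH ARM, route B (weil-grh-3).  Lemmas about a base certificate
`c : DKCert` used by `DKCert3.P3_nonneg_of_checkL` (`DualTrigKernelLattice.lean`):

* `DKCert.valTerm_comm`, `DKCert.sumVal_ncList_base` — the non-periodic part of the base function is the
  sum of the incommensurable window terms `(vals.filter ncVal).map valR`;
* `DKCert.ncList_append_nc`, `DKCert.cList_append_nc` — appending non-periodic terms (the lattice atoms);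
* `DKCert.neg_amp_le_sumVal` — the amplitude bound `−Σ termAmp / S ≤ Σ val` for a represented list.

Everything here is PROVED; no named facts, no `sorry`, no kernel evaluation.
-/

noncomputable section

open Finset Real Complex

namespace Summit.Ventures.WeilGRH

open Literature.Analysis.ValidatedNumerics.NumericsMP
open Literature.NumberTheory.LFunctions
open DualTrigTaylor DigammaVertical

namespace DKCert

variable {c : DKCert}

/-! ### The `comm` flag and the non-periodic list of the base terms -/

/-- The `comm` flag of a computed window term is "`n` is a power of `p₀`". [folklore] -/
theorem valTerm_comm {v : DKVal} {t : GTerm} (h : c.valTerm v = some t) : t.comm = !(c.ncVal v) := by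
  unfold valTerm at h
  unfold ncVal
  cases hL : MI.logNat c.S c.Kser v.p with
  | none => simp [hL] at h
  | some L =>
  cases hX : c.chiBox v with
  | none => simp [hL, hX] at h
  | some X =>
  cases hLn : MI.logNat c.S c.Kser v.n with
  | none => simp [hL, hX, hLn] at h
  | some Ln =>
  simp only [hL, hX, hLn] at h
  cases hE : logExact c.p0 v.n with
  | some e => simp only [hE, Option.some.injEq] at h; subst h; simp
  | none =>
    simp only [hE] at h
    cases hr : MI.divPos c.S (Ln.mulInt c.D) c.logp0I with
    | none => simp [hr] at h
    | some r => simp only [hr, Option.some.injEq] at h; subst h; simp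

/-- The non-periodic real terms of a window sub-list are the `valR` of its incommensurable values.
[folklore] -/
theorem ncList_vals : ∀ (vs : List DKVal) {ts : List GTerm}, (vs.map c.valTerm).mapM id = some ts →
    ncList ts (vs.map c.valR) = (vs.filter c.ncVal).map c.valR
  | [], ts, h => by simp at h; subst h; simp [ncList]
  | v :: vs, ts, h => by
      rw [List.map_cons, List.mapM_cons] at h
      cases hv : c.valTerm v with
      | none => simp [hv] at h
      | some t =>
        simp only [hv, id, Option.pure_def, Option.bind_eq_bind, Option.bind_some] at h
        cases hrest : (vs.map c.valTerm).mapM id with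
        | none => simp [hrest] at h
        | some ts' =>
          simp only [hrest, Option.bind_some, Option.some.injEq] at h
          subst h
          have ih := ncList_vals vs hrest
          have hc := valTerm_comm hv
          cases hnc : c.ncVal v
          · rw [hnc] at hc; simp only [Bool.not_false] at hc
            simp [ncList, hc, hnc, ih]
          · rw [hnc] at hc; simp only [Bool.not_true] at hc
            simp [ncList, hc, hnc, ih]

/-- The atoms are periodic: prefixing atoms does not change the non-periodic list. [folklore] -/
theorem ncList_atoms_append (ts : List GTerm) (rs : List RTerm) : ∀ (l : List DKAtom),
    ncList (l.map c.atomTerm ++ ts) (l.map c.atomR ++ rs) = ncList ts rs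
  | [] => by simp
  | atm :: l => by
      rw [List.map_cons, List.map_cons, List.cons_append, List.cons_append]
      have : (c.atomTerm atm).comm = true := rfl
      simp only [ncList, this, if_true]
      exact ncList_atoms_append ts rs l

/-- **The non-periodic part of the base function** is the sum of the incommensurable window terms.
[folklore] -/
theorem sumVal_ncList_base (hvals : c.valsOK = true) (θ : ℝ) :
    sumVal (ncList c.terms c.termsR) θ = sumVal ((c.vals.filter c.ncVal).map c.valR) θ := by
  have hsome : c.valTerms.isSome = true := by
    unfold valsOK at hvals; simp only [Bool.and_eq_true] at hvals; exact hvals.1.1.1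
  cases hvt : c.valTerms with
  | none => simp [hvt] at hsome
  | some ts =>
    unfold terms termsR
    rw [hvt, Option.getD_some, ncList_atoms_append]
    unfold valTerms at hvt
    rw [ncList_vals c.vals hvt]

/-- `ncList` of a list extended by non-periodic terms. [folklore] -/
theorem ncList_append_nc : ∀ (ts : List GTerm) (rs : List RTerm), List.Forall₂ (GRepr c.S c.R) ts rs →
    ∀ (ts' : List GTerm) (rs' : List RTerm), List.Forall₂ (GRepr c.S c.R) ts' rs' → (∀ t ∈ ts', t.comm = false) →
      ncList (ts ++ ts') (rs ++ rs') = ncList ts rs ++ rs'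
  | _, _, List.Forall₂.nil, ts', rs', hF', hnc => by
      simp only [List.nil_append]
      induction hF' with
      | nil => simp [ncList]
      | @cons t r ts rs _ _ ih =>
          have ht : t.comm = false := hnc t (by simp)
          simp only [ncList, ht, Bool.false_eq_true, if_false]
          rw [ih (fun s hs ↦ hnc s (by simp [hs]))]; simp [ncList]
  | _, _, @List.Forall₂.cons _ _ _ t r ts rs _ hF, ts', rs', hF', hnc => by
      have ih := ncList_append_nc ts rs hF ts' rs' hF' hnc
      simp only [List.cons_append, ncList]
      split_ifs <;> simp [ih]

/-- `cList` of a list extended by non-periodic terms. [folklore] -/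
theorem cList_append_nc : ∀ (ts : List GTerm) (rs : List RTerm), List.Forall₂ (GRepr c.S c.R) ts rs →
    ∀ (ts' : List GTerm) (rs' : List RTerm), List.Forall₂ (GRepr c.S c.R) ts' rs' → (∀ t ∈ ts', t.comm = false) →
      cList (ts ++ ts') (rs ++ rs') = cList ts rs
  | _, _, List.Forall₂.nil, ts', rs', hF', hnc => by
      simp only [List.nil_append]
      induction hF' with
      | nil => simp [cList]
      | @cons t r ts rs _ _ ih =>
          have ht : t.comm = false := hnc t (by simp)
          simp only [cList, ht, Bool.false_eq_true, if_false]
          exact ih (fun s hs ↦ hnc s (by simp [hs]))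
  | _, _, @List.Forall₂.cons _ _ _ t r ts rs _ hF, ts', rs', hF', hnc => by
      have ih := cList_append_nc ts rs hF ts' rs' hF' hnc
      simp only [List.cons_append, cList]
      split_ifs <;> simp [ih]

/-- The amplitude bound for a whole represented list: `−Σ termAmp / S ≤ Σ val`. [folklore] -/
theorem neg_amp_le_sumVal (hS : 0 < c.S) : ∀ (ts : List GTerm) (rts : List RTerm),
    List.Forall₂ (GRepr c.S c.R) ts rts →
      ∀ θ : ℝ, -((((ts.map termAmp).sum : ℤ) : ℝ) / c.S) ≤ sumVal rts θ
  | _, _, List.Forall₂.nil, θ => by simp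
  | _, _, @List.Forall₂.cons _ _ _ t rt ts rts hh hF, θ => by
      have ih := neg_amp_le_sumVal hS ts rts hF θ
      simp only [List.map_cons, List.sum_cons, sumVal_cons]
      have h1 := abs_val_le_termAmp hS hh θ
      rw [abs_le] at h1
      rw [Int.cast_add, add_div]
      linarith [h1.1]

end DKCert

end Summit.Ventures.WeilGRH

end
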